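import Summits.HodgeConjecture.HodgeConjecture.Theorems.HLiu418DoubledWeilMirror
import Literature.NumberTheory.GelbartRogawski1991.DoubledWeilRepresentationUndoublingConj
import Literature.NumberTheory.Automorphic.Liu2021.Def411WeilCarriersDoubling
import HarnessLib

/-!
# Undoubling commutes with the scalar-conjugate mirror: `s(mpCongr ∘ (·)ᶜ ∘ sD ∘ (H′ = H)) = splittingCongr (mirrorSplitting (s(sD)))`

Cell `hodgecm-mathlib`, floor 0, programme P5 (`Cruxes/HLiu418/Lines/F0_AlbCm.lean`), crux item `stmt-HodgeConjecture-24832`; K-E3 lane, ROAD U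
step (U3).  THEOREMS ONLY (no definition, no named fact, no instance, no `sorry`); rank-GENERIC (`N`, `M` arbitrary).

The complex-conjugate twin of ★ `undouble_relabel_comp_conjH` (`DoubledWeilRepresentationUndoublingConj`): for the doubled data at `dW` (source)
and `dW′` with `realDiagonal dW′ = −realDiagonal dW` (target), a `χ`-normalised `sD : H_{dW}(𝔸) →* Mp(𝕎^𝔻_{dW})ᶜᵒⁿᵗ` and its mirror
`sD′ := mpCongr ∘ (·)ᶜ ∘ sD ∘ (H_{dW′} = H_{dW})` (★ `HLiu418DoubledWeilMirror.isDoubledWeilRep_mirror_subgroupCongr`: `χ⁻¹`-normalised), the UNDOUBLED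
splitting of `sD′` (Kudla's `s(g) ⊗ 1 = u(g ⊕ 1)`, ★ `undouble`) IS the pair-level mirror (★ `HodgeCM.WeilCoinv.mirrorSplitting`: `(s(g))ᶜ` re-typed
along `Gram(T_V, −T_W) = −Gram(T_V, T_W)`) of the undoubled splitting of `sD`, read at the data of `dW′` (★ `splittingCongr`):
**`undoubleHom sD′ = splittingCongr (mirrorSplitting (undoubleHom sD))`** (`undoubleHom_mirror`), by the uniqueness clause ★ `undouble_unique`:
(a) projections — compatibility of `splittingCongr ∘ mirrorSplitting ∘ undoubleHom` (★ `isCompatible_splittingCongr`, ★ `isCompatible_mirrorSplitting`,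
★ `isCompatible_undoubleHom`); (b) operators — `ω(u′(g))(Φ₁ ⊠ Φ₂) = C ω(u(g)) C (Φ₁ ⊠ Φ₂)` (★ `omega_undoubleIdx_apply`, ★
`adelicMpCont.omega_adelicMpContConj_apply`, `C` commutes with re-indexing and `C (Φ₁ ⊠ Φ₂) = C Φ₁ ⊠ C Φ₂`), `= (C ω(s(g)) C Φ₁) ⊠ Φ₂`
(★ `omega_uD_tensorToSum`) `= ω(s̄(g)) Φ₁ ⊠ Φ₂`.

* §1 `conj_tensorToSum`, `omega_splittingCongr_mirrorSplitting_apply` (generic pair data), `subgroupCongr_inlG` (`(g ⊕ 1)` does not see the re-typing);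
* §2 **`undouble_mirror`**, **`undoubleHom_mirror`**.

HC_CM is proved only modulo the 7 printed citations (+ declared floor-0 debt) until rung 0 closes; this file proves nothing about them.

## References
* [Kudla1994] S. Kudla, Israel J. Math. 87 (1994), §2 (doubled space, Siegel parabolic), §3 Thm. 3.1.
* [GelbartRogawski1991] S. Gelbart, J. Rogawski, Invent. Math. 105 (1991), §3.1 p. 454, §3.2 p. 457.
* [Li1992] J.-S. Li, J. reine angew. Math. 428 (1992), p. 181.  [MoeglinVignerasWaldspurger1987] LNM 1291, Chap. 2 II.1, Chap. 3 IV.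
-/

set_option autoImplicit false
set_option linter.dupNamespace false

noncomputable section

open scoped Classical
open scoped Matrix ComplexConjugate
open NumberField IsDedekindDomain
open Literature.RepresentationTheory.HeisenbergGroup
open Literature.NumberTheory.Automorphic
open Literature.NumberTheory.Weil1964
open Literature.NumberTheory.GaloisRepresentations
open Literature.NumberTheory.GelbartRogawski1991 Literature.NumberTheory.GelbartRogawski1991.UnitaryDualPair
open Literature.NumberTheory.GelbartRogawski1991.GRConstruction
open Literature.NumberTheory.Automorphic.UnitaryGroup
open Literature.NumberTheory.Automorphic.Liu2021.Def411WeilCarriersDoubling (splittingCongr splittingCongr_rfl isCompatible_splittingCongr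
  isCompatible_undoubleHom)
open HodgeCM.WeilCoinv (mirrorSplitting mirrorSplitting_apply adelicGram_neg)
open Summit.HodgeConjecture.HodgeConjecture.Cruxes.H413.WeilFinRepMirror (isSymm_neg isUnit_det_neg' neg_eq_map_neg isCompatible_mirrorSplitting)

namespace Summit.HodgeConjecture.HodgeConjecture.Cruxes.HLiu418.DoubledWeilMirror

/-! ## §1 Complex conjugation of pure tensors; the mirror splitting read along equal W-data; `(g ⊕ 1)` and the re-typing -/

section Generic

variable {F : Type} [Field F] [NumberField F]

/-- **`C (Φ₁ ⊠ Φ₂) = C Φ₁ ⊠ C Φ₂`** on `𝒮(𝔸^{ι₁ ⊔ ι₂})`. [cite: MoeglinVignerasWaldspurger1987, Chap. 2 II.1] -/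
theorem conj_tensorToSum {ι₁ ι₂ : Type} [Fintype ι₁] [Fintype ι₂] (Φ₁ : piSchwartzBruhat F ι₁) (Φ₂ : piSchwartzBruhat F ι₂) :
    piSchwartzBruhatConj F (ι₁ ⊕ ι₂) (tensorToSum F ι₁ ι₂ Φ₁ Φ₂) =
      tensorToSum F ι₁ ι₂ (piSchwartzBruhatConj F ι₁ Φ₁) (piSchwartzBruhatConj F ι₂ Φ₂) :=
  Subtype.ext (funext fun x => by
    rw [piSchwartzBruhatConj_apply, coe_tensorToSum, coe_tensorToSum, boxTensor_apply, boxTensor_apply, map_mul,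
      piSchwartzBruhatConj_apply, piSchwartzBruhatConj_apply])

variable (F) (E : Type) [Field E] [NumberField E] [Algebra F E] (c : E ≃ₐ[F] E) (N M : ℕ) {n : ℕ} (e : Fin N × Fin M ≃ Fin n)
  (JV : Matrix (Fin N) (Fin N) E) {JW : Matrix (Fin M) (Fin M) E} {TV : Matrix (Fin N) (Fin N) F} {TW : Matrix (Fin M) (Fin M) F}

set_option maxHeartbeats 1600000 in
/-- **the mirror splitting read along equal W-data, on Weil operators**: for `hT : −T_W = T_W₂`, `hJ : −J_W = J_W₂` and elements `g₂`, `g` of the big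
groups at `J_W₂`, `J_W` with the SAME matrix, `ω_{Gram(T_V,T_W₂)}((splittingCongr hT hJ s̄) g₂) Φ = C (ω_{Gram(T_V,T_W)}(s g) (C Φ))`.
[cite: Li1992, p. 181] [cite: MoeglinVignerasWaldspurger1987, Chap. 2 II.1] -/
theorem omega_splittingCongr_mirrorSplitting_apply (s : adelicPair F E c N M JV JW →* adelicMpCont F (Fin n) (adelicGram F e TV TW))
    {TW₂ : Matrix (Fin M) (Fin M) F} {JW₂ : Matrix (Fin M) (Fin M) E} (hT : -TW = TW₂) (hJ : -JW = JW₂)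
    (g₂ : adelicPair F E c N M JV JW₂) (g : adelicPair F E c N M JV JW)
    (hg : ((g₂ : adelicPair F E c N M JV JW₂) : GL (Fin N × Fin M) (AdeleRing (𝓞 E) E)) = (g : GL (Fin N × Fin M) (AdeleRing (𝓞 E) E)))
    (Φ : piSchwartzBruhat F (Fin n)) :
    adelicMpCont.omega F (Fin n) (adelicGram F e TV TW₂) (splittingCongr F E c N M e JV hT hJ (mirrorSplitting F E c N M e JV JW s) g₂) Φ =
      piSchwartzBruhatConj F (Fin n) (adelicMpCont.omega F (Fin n) (adelicGram F e TV TW) (s g) (piSchwartzBruhatConj F (Fin n) Φ)) := by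
  subst hT hJ
  have hg' : (adelicPairNeg F E c N M JV JW).symm g₂ = g := Subtype.ext ((coe_adelicPairNeg_symm F E c N M JV JW g₂).trans hg)
  subst hg'
  rw [splittingCongr_rfl, mirrorSplitting_apply]
  exact (adelicMpCont.omega_mpCongr_apply (adelicGram_neg F N M e TV TW).symm _ Φ).trans
    (adelicMpCont.omega_adelicMpContConj_apply (s ((adelicPairNeg F E c N M JV JW).symm g₂)) Φ)

end Generic

variable (L : Type) [Field L] [NumberField L] [IsCMField L]
variable {N M n : ℕ} (e : Fin N × Fin M ≃ Fin n)
  (dV : Fin N → L) (hdV : ∀ i, IsCMField.complexConj L (dV i) = dV i) (hdV0 : ∀ i, dV i ≠ 0)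
  (dW : Fin M → L) (hdW : ∀ i, IsCMField.complexConj L (dW i) = dW i) (hdW0 : ∀ i, dW i ≠ 0)
  (dW' : Fin M → L) (hdW' : ∀ i, IsCMField.complexConj L (dW' i) = dW' i) (hdW0' : ∀ i, dW' i ≠ 0)

section InlG

variable {L e dV hdV dW hdW dW' hdW'}

/-- `diag dW′ = −diag dW` when `realDiagonal dW′ = −realDiagonal dW`. [cite: Kudla1996, V.3] -/
theorem neg_diagonal_eq (hneg : realDiagonal L dW' hdW' = -realDiagonal L dW hdW) : -Matrix.diagonal dW = Matrix.diagonal dW' :=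
  (diagonal_eq_neg hneg).symm

/-- **`(g ⊕ 1)` does not see the re-typing**: `(H_{dW′} = H_{dW}) (inlG_{dW′} g) = inlG_{dW} ((G₁′ = G₁) g)` (same matrices, ★ `coe_inlG`).
[cite: GelbartRogawski1991, §3.1 Prop. 3.1.1 p. 455 L1–2] -/
theorem subgroupCongr_inlG (hneg : realDiagonal L dW' hdW' = -realDiagonal L dW hdW)
    (g' : adelicPair (Fp L) L (IsCMField.complexConj L) N M (Matrix.diagonal dV) (Matrix.diagonal dW')) :
    (MulEquiv.subgroupCongr (HA_eq (e := e) (dV := dV) (hdV := hdV) hneg)).toMonoidHom (inlG L e dV hdV dW' hdW' g') =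
      inlG L e dV hdV dW hdW (MulEquiv.subgroupCongr (adelicPair_eq (dV := dV) hneg) g') :=
  Subtype.ext ((MulEquiv.subgroupCongr_apply (HA_eq (e := e) (dV := dV) (hdV := hdV) hneg) _).trans
    ((coe_inlG L e dV hdV dW' hdW' g').trans
      ((congrArg (fun x : GL (Fin N × Fin M) (AdeleRing (𝓞 L) L) =>
          UnitaryGroup.reindexGL (e₂ (n := n)) (UnitaryGroup.blockDiagGL (UnitaryGroup.reindexGL e x, 1)))
        (MulEquiv.subgroupCongr_apply (adelicPair_eq (dV := dV) hneg) g').symm).trans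
        (coe_inlG L e dV hdV dW hdW _).symm)))

end InlG

/-! ## §2 Undoubling commutes with the scalar-conjugate mirror -/

section Undouble

variable {L e dV hdV dW hdW dW' hdW'}

set_option maxHeartbeats 4000000 in
-- (the telescopes of BOTH data, the undoubling index change and the conjugate-model casts; every step is a term)
/-- **UNDOUBLING COMMUTES WITH THE MIRROR: `undouble sD′ g′ = (splittingCongr (mirrorSplitting (undoubleHom sD))) g′`** for `sD` `χ`-normalised at `dW`,
`sD′ = mpCongr ∘ (·)ᶜ ∘ sD ∘ (H_{dW′} = H_{dW})` (`χ⁻¹`-normalised at `dW′`, ★ `isDoubledWeilRep_mirror_subgroupCongr`), by ★ `undouble_unique` at `dW′`: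
(a) the right-hand side lies over `ι′(g′)` (compatibility of `splittingCongr ∘ mirrorSplitting ∘ undoubleHom`); (b) `ω(u′(g′))(Φ₁ ⊠ Φ₂) =
C (ω(u(g)) (C Φ₁ ⊠ C Φ₂)) = (C ω(s(g)) C Φ₁) ⊠ Φ₂ = ω(RHS) Φ₁ ⊠ Φ₂`, `g` = `g′` read in `G₁(𝔸)`.
[cite: Kudla1994, §2 (doubled space, Siegel parabolic), Thm. 3.1] [cite: GelbartRogawski1991, §3.1 p. 454] [cite: Li1992, p. 181] -/
theorem undouble_mirror (hdV0 : ∀ i, dV i ≠ 0) (hdW0 : ∀ i, dW i ≠ 0) (hdW0' : ∀ i, dW' i ≠ 0)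
    (hneg : realDiagonal L dW' hdW' = -realDiagonal L dW hdW) (χ : HeckeCharacter L) (hχu : χ.IsUnitary)
    {sD : HA L e dV hdV dW hdW →* MpD L e dV hdV dW hdW} (hsD : IsDoubledWeilRep L e dV hdV hdV0 dW hdW hdW0 χ sD)
    (g' : adelicPair (Fp L) L (IsCMField.complexConj L) N M (Matrix.diagonal dV) (Matrix.diagonal dW')) :
    undouble L e dV hdV hdV0 dW' hdW' hdW0' (isDoubledWeilRep_mirror_subgroupCongr hdV0 hdW0 hdW0' hneg χ hχu hsD).proj_eq g' =
      splittingCongr (Fp L) L (IsCMField.complexConj L) N M e (Matrix.diagonal dV) hneg.symm (neg_diagonal_eq hneg)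
        (mirrorSplitting (Fp L) L (IsCMField.complexConj L) N M e (Matrix.diagonal dV) (Matrix.diagonal dW)
          (undoubleHom L e dV hdV hdV0 dW hdW hdW0 sD hsD.proj_eq)) g' := by
  symm
  -- `g′` read in `G₁(𝔸)` (same matrix)
  have hg : ((g' : adelicPair (Fp L) L (IsCMField.complexConj L) N M (Matrix.diagonal dV) (Matrix.diagonal dW')) :
        GL (Fin N × Fin M) (AdeleRing (𝓞 L) L)) =
      (MulEquiv.subgroupCongr (adelicPair_eq (dV := dV) hneg) g' : adelicPair (Fp L) L (IsCMField.complexConj L) N M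
        (Matrix.diagonal dV) (Matrix.diagonal dW)) :=
    (MulEquiv.subgroupCongr_apply (adelicPair_eq (dV := dV) hneg) g').symm
  refine undouble_unique L e dV hdV hdV0 dW' hdW' hdW0' _ g' _ ?_ fun Φ₁ Φ₂ => ?_
  · -- (a) compatibility of `splittingCongr ∘ mirrorSplitting ∘ undoubleHom` gives the projection
    exact (isCompatible_splittingCongr (Fp L) L (IsCMField.complexConj L) N M e (Matrix.diagonal dV) (complexConj_imagUnit L)
      (imagUnit_ne_zero L) (imagUnit_mul_self L) (realDiagonal_isSymm L dV hdV) (isUnit_det_realDiagonal L dV hdV hdV0)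
      (realDiagonal_map L dV hdV).symm hneg.symm (neg_diagonal_eq hneg) (isSymm_neg (realDiagonal_isSymm L dW hdW))
      (realDiagonal_isSymm L dW' hdW') (isUnit_det_neg' (isUnit_det_realDiagonal L dW hdW hdW0))
      (isUnit_det_realDiagonal L dW' hdW' hdW0') (neg_eq_map_neg (realDiagonal_map L dW hdW).symm) (realDiagonal_map L dW' hdW').symm
      (isCompatible_mirrorSplitting (Fp L) L (IsCMField.complexConj L) N M e (Matrix.diagonal dV) (Matrix.diagonal dW)
        (complexConj_imagUnit L) (imagUnit_ne_zero L) (imagUnit_mul_self L) (realDiagonal_isSymm L dV hdV) (realDiagonal_isSymm L dW hdW)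
        (isUnit_det_realDiagonal L dV hdV hdV0) (isUnit_det_realDiagonal L dW hdW hdW0) (realDiagonal_map L dV hdV).symm
        (realDiagonal_map L dW hdW).symm (isCompatible_undoubleHom L e dV hdV hdV0 dW hdW hdW0 χ hsD))).1 g'
  · -- (b) the product formula.  `ω(u′(g′)) Ψ = R (ω(mpCongr (sD (g ⊕ 1))ᶜ) (R⁻¹ Ψ)) = R (C (ω(sD (g ⊕ 1)) (C (R⁻¹ Ψ))))`
    have u1 := omega_undoubleIdx_apply (e := e) (dV := dV) (hdV := hdV) dW' hdW'
      ((((mpCongr (gramDA_eq_neg (e := e) (dV := dV) (hdV := hdV) hneg).symm).toMonoidHom.comp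
          ((adelicMpContConj (Fp L) (Fin (n + n)) (gramDA L e dV hdV dW hdW)).toMonoidHom.comp sD)).comp
        (MulEquiv.subgroupCongr (HA_eq (e := e) (dV := dV) (hdV := hdV) hneg)).toMonoidHom) (inlG L e dV hdV dW' hdW' g'))
      (tensorToSum (Fp L) (Fin n) (Fin n) Φ₁ Φ₂)
    have u2 : (((mpCongr (gramDA_eq_neg (e := e) (dV := dV) (hdV := hdV) hneg).symm).toMonoidHom.comp
          ((adelicMpContConj (Fp L) (Fin (n + n)) (gramDA L e dV hdV dW hdW)).toMonoidHom.comp sD)).comp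
        (MulEquiv.subgroupCongr (HA_eq (e := e) (dV := dV) (hdV := hdV) hneg)).toMonoidHom) (inlG L e dV hdV dW' hdW' g') =
      mpCongr (gramDA_eq_neg (e := e) (dV := dV) (hdV := hdV) hneg).symm
        (adelicMpContConj (Fp L) (Fin (n + n)) (gramDA L e dV hdV dW hdW)
          (sD (inlG L e dV hdV dW hdW (MulEquiv.subgroupCongr (adelicPair_eq (dV := dV) hneg) g')))) :=
      (mirror_apply hneg sD _).trans (congrArg (fun h => mpCongr (gramDA_eq_neg (e := e) (dV := dV) (hdV := hdV) hneg).symm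
        (adelicMpContConj (Fp L) (Fin (n + n)) (gramDA L e dV hdV dW hdW) (sD h))) (subgroupCongr_inlG hneg g'))
    have u3 := (adelicMpCont.omega_mpCongr_apply (gramDA_eq_neg (e := e) (dV := dV) (hdV := hdV) hneg).symm
        (adelicMpContConj (Fp L) (Fin (n + n)) (gramDA L e dV hdV dW hdW)
          (sD (inlG L e dV hdV dW hdW (MulEquiv.subgroupCongr (adelicPair_eq (dV := dV) hneg) g'))))
        ((piSBReindex (Fp L) (e₂ (n := n)).symm).symm (tensorToSum (Fp L) (Fin n) (Fin n) Φ₁ Φ₂))).trans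
      (adelicMpCont.omega_adelicMpContConj_apply
        (sD (inlG L e dV hdV dW hdW (MulEquiv.subgroupCongr (adelicPair_eq (dV := dV) hneg) g')))
        ((piSBReindex (Fp L) (e₂ (n := n)).symm).symm (tensorToSum (Fp L) (Fin n) (Fin n) Φ₁ Φ₂)))
    -- `C` commutes with the re-indexings and with `⊠`; the doubled operator at `dW` on `C Φ₁ ⊠ C Φ₂` is `u(g)`
    have u4 := omega_undoubleIdx_apply (e := e) (dV := dV) (hdV := hdV) dW hdW
      (sD (inlG L e dV hdV dW hdW (MulEquiv.subgroupCongr (adelicPair_eq (dV := dV) hneg) g')))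
      (tensorToSum (Fp L) (Fin n) (Fin n) (piSchwartzBruhatConj (Fp L) (Fin n) Φ₁) (piSchwartzBruhatConj (Fp L) (Fin n) Φ₂))
    have u5 := omega_uD_tensorToSum L e dV hdV hdV0 dW hdW hdW0 hsD.proj_eq (MulEquiv.subgroupCongr (adelicPair_eq (dV := dV) hneg) g')
      (piSchwartzBruhatConj (Fp L) (Fin n) Φ₁) (piSchwartzBruhatConj (Fp L) (Fin n) Φ₂)
    -- the right-hand side's operator on `Φ₁`
    have u6 := omega_splittingCongr_mirrorSplitting_apply (Fp L) L (IsCMField.complexConj L) N M e (Matrix.diagonal dV)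
      (undoubleHom L e dV hdV hdV0 dW hdW hdW0 sD hsD.proj_eq) hneg.symm (neg_diagonal_eq hneg) g'
      (MulEquiv.subgroupCongr (adelicPair_eq (dV := dV) hneg) g') hg Φ₁
    -- assemble (a `calc` of terms; consecutive members agree up to unfolding `uD`, `undoubleHom`)
    calc adelicMpCont.omega (Fp L) (Fin n ⊕ Fin n) (gramS L e dV hdV dW' hdW')
          (uD L e dV hdV dW' hdW'
            (((mpCongr (gramDA_eq_neg (e := e) (dV := dV) (hdV := hdV) hneg).symm).toMonoidHom.comp
                ((adelicMpContConj (Fp L) (Fin (n + n)) (gramDA L e dV hdV dW hdW)).toMonoidHom.comp sD)).comp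
              (MulEquiv.subgroupCongr (HA_eq (e := e) (dV := dV) (hdV := hdV) hneg)).toMonoidHom) g')
          (tensorToSum (Fp L) (Fin n) (Fin n) Φ₁ Φ₂)
        = piSBReindex (Fp L) (e₂ (n := n)).symm
            (adelicMpCont.omega (Fp L) (Fin (n + n)) (gramDA L e dV hdV dW' hdW')
              (mpCongr (gramDA_eq_neg (e := e) (dV := dV) (hdV := hdV) hneg).symm
                (adelicMpContConj (Fp L) (Fin (n + n)) (gramDA L e dV hdV dW hdW)
                  (sD (inlG L e dV hdV dW hdW (MulEquiv.subgroupCongr (adelicPair_eq (dV := dV) hneg) g')))))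
              ((piSBReindex (Fp L) (e₂ (n := n)).symm).symm (tensorToSum (Fp L) (Fin n) (Fin n) Φ₁ Φ₂))) :=
          u1.trans (congrArg (fun q => piSBReindex (Fp L) (e₂ (n := n)).symm
            (adelicMpCont.omega (Fp L) (Fin (n + n)) (gramDA L e dV hdV dW' hdW') q
              ((piSBReindex (Fp L) (e₂ (n := n)).symm).symm (tensorToSum (Fp L) (Fin n) (Fin n) Φ₁ Φ₂)))) u2)
      _ = piSBReindex (Fp L) (e₂ (n := n)).symm
            (piSchwartzBruhatConj (Fp L) (Fin (n + n))
              (adelicMpCont.omega (Fp L) (Fin (n + n)) (gramDA L e dV hdV dW hdW)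
                (sD (inlG L e dV hdV dW hdW (MulEquiv.subgroupCongr (adelicPair_eq (dV := dV) hneg) g')))
                (piSchwartzBruhatConj (Fp L) (Fin (n + n))
                  ((piSBReindex (Fp L) (e₂ (n := n)).symm).symm (tensorToSum (Fp L) (Fin n) (Fin n) Φ₁ Φ₂))))) :=
          congrArg (piSBReindex (Fp L) (e₂ (n := n)).symm) u3
      _ = piSchwartzBruhatConj (Fp L) (Fin n ⊕ Fin n) (piSBReindex (Fp L) (e₂ (n := n)).symm
              (adelicMpCont.omega (Fp L) (Fin (n + n)) (gramDA L e dV hdV dW hdW)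
                (sD (inlG L e dV hdV dW hdW (MulEquiv.subgroupCongr (adelicPair_eq (dV := dV) hneg) g')))
                (piSchwartzBruhatConj (Fp L) (Fin (n + n))
                  ((piSBReindex (Fp L) (e₂ (n := n)).symm).symm (tensorToSum (Fp L) (Fin n) (Fin n) Φ₁ Φ₂))))) :=
          (piSchwartzBruhatConj_piSBReindex (e₂ (n := n)).symm _).symm
      _ = piSchwartzBruhatConj (Fp L) (Fin n ⊕ Fin n) (piSBReindex (Fp L) (e₂ (n := n)).symm
              (adelicMpCont.omega (Fp L) (Fin (n + n)) (gramDA L e dV hdV dW hdW)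
                (sD (inlG L e dV hdV dW hdW (MulEquiv.subgroupCongr (adelicPair_eq (dV := dV) hneg) g')))
                ((piSBReindex (Fp L) (e₂ (n := n)).symm).symm
                  (tensorToSum (Fp L) (Fin n) (Fin n) (piSchwartzBruhatConj (Fp L) (Fin n) Φ₁) (piSchwartzBruhatConj (Fp L) (Fin n) Φ₂))))) :=
          congrArg (fun Θ => piSchwartzBruhatConj (Fp L) (Fin n ⊕ Fin n) (piSBReindex (Fp L) (e₂ (n := n)).symm
              (adelicMpCont.omega (Fp L) (Fin (n + n)) (gramDA L e dV hdV dW hdW)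
                (sD (inlG L e dV hdV dW hdW (MulEquiv.subgroupCongr (adelicPair_eq (dV := dV) hneg) g'))) Θ)))
            ((piSchwartzBruhatConj_piSBReindex_symm (e₂ (n := n)).symm _).trans
              (congrArg ((piSBReindex (Fp L) (e₂ (n := n)).symm).symm) (conj_tensorToSum Φ₁ Φ₂)))
      _ = piSchwartzBruhatConj (Fp L) (Fin n ⊕ Fin n)
            (adelicMpCont.omega (Fp L) (Fin n ⊕ Fin n) (gramS L e dV hdV dW hdW)
              (uD L e dV hdV dW hdW sD (MulEquiv.subgroupCongr (adelicPair_eq (dV := dV) hneg) g'))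
              (tensorToSum (Fp L) (Fin n) (Fin n) (piSchwartzBruhatConj (Fp L) (Fin n) Φ₁) (piSchwartzBruhatConj (Fp L) (Fin n) Φ₂))) :=
          congrArg (piSchwartzBruhatConj (Fp L) (Fin n ⊕ Fin n)) u4.symm
      _ = piSchwartzBruhatConj (Fp L) (Fin n ⊕ Fin n)
            (tensorToSum (Fp L) (Fin n) (Fin n)
              (adelicMpCont.omega (Fp L) (Fin n) (gramA L e dV hdV dW hdW)
                (undouble L e dV hdV hdV0 dW hdW hdW0 hsD.proj_eq (MulEquiv.subgroupCongr (adelicPair_eq (dV := dV) hneg) g'))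
                (piSchwartzBruhatConj (Fp L) (Fin n) Φ₁))
              (piSchwartzBruhatConj (Fp L) (Fin n) Φ₂)) :=
          congrArg (piSchwartzBruhatConj (Fp L) (Fin n ⊕ Fin n)) u5
      _ = tensorToSum (Fp L) (Fin n) (Fin n)
            (piSchwartzBruhatConj (Fp L) (Fin n)
              (adelicMpCont.omega (Fp L) (Fin n) (gramA L e dV hdV dW hdW)
                (undouble L e dV hdV hdV0 dW hdW hdW0 hsD.proj_eq (MulEquiv.subgroupCongr (adelicPair_eq (dV := dV) hneg) g'))
                (piSchwartzBruhatConj (Fp L) (Fin n) Φ₁)))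
            Φ₂ :=
          (conj_tensorToSum _ _).trans (congrArg (tensorToSum (Fp L) (Fin n) (Fin n) _) (piSchwartzBruhatConj_piSchwartzBruhatConj Φ₂))
      _ = _ := congrArg (fun A => tensorToSum (Fp L) (Fin n) (Fin n) A Φ₂) u6.symm

/-- **Hom form: `undoubleHom sD′ = splittingCongr (mirrorSplitting (undoubleHom sD))`.** [cite: Kudla1994, §2 (doubled space, Siegel parabolic), Thm. 3.1]
[cite: GelbartRogawski1991, §3.1 p. 454] [cite: Li1992, p. 181] -/
theorem undoubleHom_mirror (hdV0 : ∀ i, dV i ≠ 0) (hdW0 : ∀ i, dW i ≠ 0) (hdW0' : ∀ i, dW' i ≠ 0)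
    (hneg : realDiagonal L dW' hdW' = -realDiagonal L dW hdW) (χ : HeckeCharacter L) (hχu : χ.IsUnitary)
    {sD : HA L e dV hdV dW hdW →* MpD L e dV hdV dW hdW} (hsD : IsDoubledWeilRep L e dV hdV hdV0 dW hdW hdW0 χ sD) :
    undoubleHom L e dV hdV hdV0 dW' hdW' hdW0' _ (isDoubledWeilRep_mirror_subgroupCongr hdV0 hdW0 hdW0' hneg χ hχu hsD).proj_eq =
      splittingCongr (Fp L) L (IsCMField.complexConj L) N M e (Matrix.diagonal dV) hneg.symm (neg_diagonal_eq hneg)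
        (mirrorSplitting (Fp L) L (IsCMField.complexConj L) N M e (Matrix.diagonal dV) (Matrix.diagonal dW)
          (undoubleHom L e dV hdV hdV0 dW hdW hdW0 sD hsD.proj_eq)) :=
  MonoidHom.ext fun g' => undouble_mirror hdV0 hdW0 hdW0' hneg χ hχu hsD g'

end Undouble

end Summit.HodgeConjecture.HodgeConjecture.Cruxes.HLiu418.DoubledWeilMirror

end
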